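import Summits.QuantumFields.GaugeBoot.DiagonalRPTorusHalfAction
import Summits.QuantumFields.GaugeBoot.DiagonalRPTorusClusterTerms
import HarnessLib

/-!
# The half-action trick on a Polyakov pair (gauge-boot, task L3 sequel `d = 3`, `L = 4`; 1/5)

HONEST FRAMING (cell `pub-gaugeboot`, page 1 of every file): the venture produces certified bounds
on lattice expectations at stated coupling, gauge group, dimension and torus size; NOT a mass gap,
NOT a continuum limit, NOT a string tension; NOT Yang–Mills-summit-bearing (barriers
`FixedCouplingUltralocality`, `PerturbativeInvisibility`). This module is bookkeeping for a
structural NEGATIVE result (`DiagonalRPTorusInnerHalfNegativeThreeAll`: inner-half diagonal RP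
fails on every even THREE-torus `L ≥ 4`, `L = 4` included, at small coupling); it discharges
nothing by itself.

## Content (three-torus `(ℤ/L)³`, mirror `x₀ = x₁`, any compact `G`, continuous `ρ`)

The Polyakov-pair witness `A = P_X - P_Y` of `DiagonalRPTorusInnerHalfNegativeEvenSUN` (L3(π))
run through the HALF-ACTION TRICK of `DiagonalRPTorusHalfAction`: the RP test observable is
`F = A · e^{-β halfSum}`, and its RP expectation is a positive multiple of the TRICK FORM
`∫ A(ΘU) A(U) ∏_{q ∈ rest} e^{β Re tr ρ(U_q)} ∏ dU` (`DiagRPTube.wilsonExpectation_trick_eq`).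

* the observable `U ↦ P_X(U) - P_Y(U)` (real parts of the traces of the vertical Polyakov loops
  over the columns `X, Y ∈ (ℤ/L)²`; written out, no new definition),
  `(P_X - P_Y) ∘ Θ = P_{θX} - P_{θY}` (`polDiff_configDiagSwap`);
* **`trickForm_polDiff_eq_sum`** — the cluster expansion of the trick form over the REST
  plaquettes only:
  `trickForm = Σ_{S ⊆ rest} (T_S(θX,X) - T_S(θX,Y) - T_S(θY,X) + T_S(θY,Y))`
  with the pair terms `T_S(A,B) = ∫ P_A P_B ∏_{p ∈ S} (e^{β Re tr ρ(U_p)} - 1)` of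
  `DiagonalRPTorusClusterTerms` (compare `DiagRPSUN.rpForm_eq_sum`, the expansion of the plain RP
  form over ALL plaquettes);
* `isInnerHalfObservable_polDiff` — `P_X - P_Y` is an inner-half observable when both columns lie
  on layers `δ` with `δ.val < L/2`;
* `abs_sum_pairTerm_filter_lt_card_le` and two corollaries — the crude tail bound
  `|Σ_{S ⊆ R, 2L < |S|} T_S| ≤ 2^{|R|} N² (2βN)^{2L+1}`.

Elementary bookkeeping; no named fact.
-/

open MeasureTheory Complex Finset Function
open scoped ComplexOrder

namespace Summit.QuantumFields.GaugeBoot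

open Literature.MathematicalPhysics.QuantumFieldTheory

noncomputable section

namespace DiagRPRest

open DiagRPThree DiagRPPolyakov DiagRPSUN

/-! ## The Polyakov pair observable -/

section PolDiff

variable {L : ℕ} [NeZero L] {N : ℕ} {G : Type*} [Group G] [TopologicalSpace G]
  [IsTopologicalGroup G] [CompactSpace G] [MeasurableSpace G] [BorelSpace G]
  [SecondCountableTopology G] (ρ : G →* Matrix (Fin N) (Fin N) ℂ) (β : ℝ)

omit [NeZero L] [TopologicalSpace G] [IsTopologicalGroup G] [CompactSpace G] [MeasurableSpace G]
  [BorelSpace G] [SecondCountableTopology G] in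
/-- `(P_X - P_Y) ∘ Θ = P_{θX} - P_{θY}`, `θ(a,b) = (b,a)`. -/
theorem polDiff_configDiagSwap (X Y : ZMod L × ZMod L) (U : GaugeConfig 3 L G) :
    polRe ρ 2 (configDiagSwap (0 : Fin 3) 1 U) (vsite X 0) -
        polRe ρ 2 (configDiagSwap (0 : Fin 3) 1 U) (vsite Y 0) =
      polRe ρ 2 U (vsite X.swap 0) - polRe ρ 2 U (vsite Y.swap 0) := by
  rw [polRe_configDiagSwap_vsite, polRe_configDiagSwap_vsite]

omit [NeZero L] [CompactSpace G] [MeasurableSpace G] [BorelSpace G] [SecondCountableTopology G] in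
/-- The Polyakov pair observable `P_X - P_Y` is continuous. -/
theorem continuous_polDiff (hρ : Continuous ρ) (X Y : ZMod L × ZMod L) :
    Continuous fun U : GaugeConfig 3 L G => polRe ρ 2 U (vsite X 0) - polRe ρ 2 U (vsite Y 0) :=
  (continuous_polRe ρ hρ 2 _).sub (continuous_polRe ρ hρ 2 _)

omit [NeZero L] [TopologicalSpace G] [IsTopologicalGroup G] [CompactSpace G] [MeasurableSpace G]
  [BorelSpace G] [SecondCountableTopology G] in
/-- **`P_X - P_Y` is an inner-half observable** of the mirror `x₀ = x₁` whenever both columns lie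
on layers `δ = a - b` with `δ.val < L/2` (the Polyakov loop over `(a,b)` reads only the vertical
links over its column, whose endpoints lie on the layer `a - b`). -/
theorem isInnerHalfObservable_polDiff {X Y : ZMod L × ZMod L} (hX : (X.1 - X.2).val < L / 2)
    (hY : (Y.1 - Y.2).val < L / 2) : IsInnerHalfObservable (0 : Fin 3) 1
      fun U : GaugeConfig 3 L G => polRe ρ 2 U (vsite X 0) - polRe ρ 2 U (vsite Y 0) := by
  intro U V hUV
  have key : ∀ A : ZMod L × ZMod L, (A.1 - A.2).val < L / 2 →
      polRe ρ 2 U (vsite A 0) = polRe ρ 2 V (vsite A 0) := by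
    intro A hA
    refine polRe_congr ρ (show (2 : Fin 3) ≠ 0 by decide) (show (2 : Fin 3) ≠ 1 by decide)
      (vsite A 0) fun z hz => hUV _ ?_ ?_
    · rw [hz, vsite_zero, vsite_one]
      exact hA
    · dsimp only
      rw [WilsonRP.shift_apply_of_ne z (show (0 : Fin 3) ≠ 2 by decide),
        WilsonRP.shift_apply_of_ne z (show (1 : Fin 3) ≠ 2 by decide), hz, vsite_zero, vsite_one]
      exact hA
  dsimp only
  rw [key X hX, key Y hY]

end PolDiff

/-! ## The cluster expansion of the trick form over the rest -/

section Expansion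

variable {L : ℕ} [NeZero L] {N : ℕ} {G : Type*} [Group G] [TopologicalSpace G]
  [IsTopologicalGroup G] [CompactSpace G] [MeasurableSpace G] [BorelSpace G]
  [SecondCountableTopology G] (ρ : G →* Matrix (Fin N) (Fin N) ℂ) (β : ℝ)

omit [SecondCountableTopology G] [MeasurableSpace G] [BorelSpace G] [IsTopologicalGroup G]
  [CompactSpace G] [TopologicalSpace G] in
/-- The rest weight expands into the plaquette factors: `∏_{q ∈ R} e^{β Re tr ρ(U_q)} =
Σ_{S ⊆ R} ∏_{p ∈ S} g_p`. -/
theorem restWeight_eq_sum (h : ℕ) (U : GaugeConfig 3 L G) :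
    DiagRPTube.restWeight ρ (0 : Fin 3) 1 h β U =
      ∑ S ∈ (DiagRPTube.restPlaqs (L := L) (0 : Fin 3) 1 h).powerset, ∏ p ∈ S, gfac ρ β p U := by
  unfold DiagRPTube.restWeight
  have h1 : (fun q => Real.exp (β * WilsonRP.plaqRe ρ U q)) = fun q => gfac ρ β q U + 1 := by
    funext q; unfold gfac; ring
  rw [h1, prod_add]
  simp

/-- ★ **Cluster expansion of the trick form of a Polyakov pair over the REST plaquettes**:
`trickForm(P_X - P_Y) = Σ_{S ⊆ rest} (T_S(θX,X) - T_S(θX,Y) - T_S(θY,X) + T_S(θY,Y))`. -/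
theorem trickForm_polDiff_eq_sum (hρ : Continuous ρ) (h : ℕ) (X Y : ZMod L × ZMod L) :
    DiagRPTube.trickForm ρ (0 : Fin 3) 1 h β
        (fun U : GaugeConfig 3 L G => polRe ρ 2 U (vsite X 0) - polRe ρ 2 U (vsite Y 0)) =
      ∑ S ∈ (DiagRPTube.restPlaqs (L := L) (0 : Fin 3) 1 h).powerset,
        (pairTerm ρ β S X.swap X - pairTerm ρ β S X.swap Y - pairTerm ρ β S Y.swap X +
          pairTerm ρ β S Y.swap Y) := by
  set PS := (DiagRPTube.restPlaqs (L := L) (0 : Fin 3) 1 h).powerset with hPS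
  have hI : ∀ (S : Finset (Plaquette 3 L)) (A B : ZMod L × ZMod L), Integrable
      (fun U : GaugeConfig 3 L G => polRe ρ 2 U (vsite A 0) * polRe ρ 2 U (vsite B 0) *
        ∏ p ∈ S, gfac ρ β p U) (Measure.pi fun _ : Edge 3 L => haarProbability G) :=
    fun S A B => integrable_of_continuous_config (continuous_pairIntegrand ρ β hρ S A B)
  have hterm : ∀ S : Finset (Plaquette 3 L),
      ∫ U, (polRe ρ 2 U (vsite X.swap 0) - polRe ρ 2 U (vsite Y.swap 0)) *
          (polRe ρ 2 U (vsite X 0) - polRe ρ 2 U (vsite Y 0)) * ∏ p ∈ S, gfac ρ β p U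
        ∂Measure.pi (fun _ : Edge 3 L => haarProbability G) =
      pairTerm ρ β S X.swap X - pairTerm ρ β S X.swap Y - pairTerm ρ β S Y.swap X +
        pairTerm ρ β S Y.swap Y := by
    intro S
    have hXX := hI S X.swap X
    have hXY := hI S X.swap Y
    have hYX := hI S Y.swap X
    have hYY := hI S Y.swap Y
    have h12 : Integrable (fun U : GaugeConfig 3 L G =>
        polRe ρ 2 U (vsite X.swap 0) * polRe ρ 2 U (vsite X 0) * ∏ p ∈ S, gfac ρ β p U -
          polRe ρ 2 U (vsite X.swap 0) * polRe ρ 2 U (vsite Y 0) * ∏ p ∈ S, gfac ρ β p U)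
        (Measure.pi fun _ : Edge 3 L => haarProbability G) := hXX.sub hXY
    have h123 : Integrable (fun U : GaugeConfig 3 L G =>
        polRe ρ 2 U (vsite X.swap 0) * polRe ρ 2 U (vsite X 0) * ∏ p ∈ S, gfac ρ β p U -
          polRe ρ 2 U (vsite X.swap 0) * polRe ρ 2 U (vsite Y 0) * ∏ p ∈ S, gfac ρ β p U -
          polRe ρ 2 U (vsite Y.swap 0) * polRe ρ 2 U (vsite X 0) * ∏ p ∈ S, gfac ρ β p U)
        (Measure.pi fun _ : Edge 3 L => haarProbability G) := h12.sub hYX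
    unfold pairTerm
    rw [← integral_sub hXX hXY, ← integral_sub h12 hYX, ← integral_add h123 hYY]
    exact integral_congr_ae (ae_of_all _ fun U => by ring)
  have hIt : ∀ S : Finset (Plaquette 3 L), Integrable
      (fun U : GaugeConfig 3 L G => (polRe ρ 2 U (vsite X.swap 0) - polRe ρ 2 U (vsite Y.swap 0)) *
        (polRe ρ 2 U (vsite X 0) - polRe ρ 2 U (vsite Y 0)) * ∏ p ∈ S, gfac ρ β p U)
      (Measure.pi fun _ : Edge 3 L => haarProbability G) := fun S =>
    integrable_of_continuous_config ((((continuous_polRe ρ hρ 2 _).sub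
      (continuous_polRe ρ hρ 2 _)).mul ((continuous_polRe ρ hρ 2 _).sub
      (continuous_polRe ρ hρ 2 _))).mul (continuous_finsetProd _ fun p _ => continuous_gfac ρ β hρ p))
  unfold DiagRPTube.trickForm
  simp_rw [polDiff_configDiagSwap, restWeight_eq_sum ρ β h, ← hPS, mul_sum]
  rw [integral_finsetSum _ fun S _ => hIt S]
  exact sum_congr rfl fun S _ => hterm S

omit [SecondCountableTopology G] in
/-- **The tail**: `|Σ_{S ⊆ R, 2L < |S|} T_S(A,B)| ≤ 2^{|R|} N² (2βN)^{2L+1}` for `0 ≤ β`,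
`2βN ≤ 1`. -/
theorem abs_sum_pairTerm_filter_lt_card_le (hρ : Continuous ρ) (hβ : 0 ≤ β) (hγ : 2 * β * N ≤ 1)
    (R : Finset (Plaquette 3 L)) (A B : ZMod L × ZMod L) :
    |∑ S ∈ R.powerset.filter (fun S => 2 * L < S.card), pairTerm ρ β S A B| ≤
      2 ^ R.card * (N ^ 2 * (2 * β * N) ^ (2 * L + 1)) := by
  have hβN : β * N ≤ 1 := by nlinarith [mul_nonneg hβ (Nat.cast_nonneg N : (0 : ℝ) ≤ N)]
  have hγ0 : 0 ≤ 2 * β * N := by positivity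
  calc |∑ S ∈ R.powerset.filter (fun S => 2 * L < S.card), pairTerm ρ β S A B|
      ≤ ∑ S ∈ R.powerset.filter (fun S => 2 * L < S.card), |pairTerm ρ β S A B| :=
        abs_sum_le_sum_abs _ _
    _ ≤ ∑ _S ∈ R.powerset.filter (fun S => 2 * L < S.card), N ^ 2 * (2 * β * N) ^ (2 * L + 1) :=
        sum_le_sum fun S hS => (abs_pairTerm_le ρ β hρ hβ hβN S A B).trans
          (mul_le_mul_of_nonneg_left (pow_le_pow_of_le_one hγ0 hγ (mem_filter.1 hS).2)
            (by positivity))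
    _ ≤ 2 ^ R.card * (N ^ 2 * (2 * β * N) ^ (2 * L + 1)) := by
        rw [sum_const, nsmul_eq_mul]
        refine mul_le_mul_of_nonneg_right ?_ (by positivity)
        calc ((R.powerset.filter fun S => 2 * L < S.card).card : ℝ) ≤ R.powerset.card := by
              exact_mod_cast card_filter_le _ _
          _ = 2 ^ R.card := by rw [card_powerset]; push_cast; ring

omit [SecondCountableTopology G] in
/-- **Splitting a cluster sum at order `2L`**: if `T_S = 0` for every `S ⊆ R` with `|S| ≤ 2L`,
then `|Σ_{S ⊆ R} T_S| ≤ 2^{|R|} N² (2βN)^{2L+1}`. -/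
theorem abs_sum_pairTerm_le_of_vanish (hρ : Continuous ρ) (hβ : 0 ≤ β) (hγ : 2 * β * N ≤ 1)
    (R : Finset (Plaquette 3 L)) (A B : ZMod L × ZMod L)
    (h0 : ∀ S ∈ R.powerset, S.card ≤ 2 * L → pairTerm ρ β S A B = 0) :
    |∑ S ∈ R.powerset, pairTerm ρ β S A B| ≤ 2 ^ R.card * (N ^ 2 * (2 * β * N) ^ (2 * L + 1)) := by
  rw [← sum_filter_add_sum_filter_not R.powerset (fun S => 2 * L < S.card)]
  have hz : ∑ S ∈ R.powerset.filter (fun S => ¬ 2 * L < S.card), pairTerm ρ β S A B = 0 :=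
    sum_eq_zero fun S hS => h0 S (mem_filter.1 hS).1 (not_lt.1 (mem_filter.1 hS).2)
  rw [hz, add_zero]
  exact abs_sum_pairTerm_filter_lt_card_le ρ β hρ hβ hγ R A B

omit [SecondCountableTopology G] in
/-- **Splitting a cluster sum at order `2L` with one surviving set**: if `T_S = 0` for every
`S ⊆ R` with `|S| ≤ 2L` other than `S₀` (`S₀ ⊆ R`, `|S₀| ≤ 2L`), then
`|Σ_{S ⊆ R} T_S - T_{S₀}| ≤ 2^{|R|} N² (2βN)^{2L+1}`. -/
theorem abs_sum_pairTerm_sub_le_of_vanish (hρ : Continuous ρ) (hβ : 0 ≤ β) (hγ : 2 * β * N ≤ 1)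
    (R : Finset (Plaquette 3 L)) (A B : ZMod L × ZMod L) {S₀ : Finset (Plaquette 3 L)}
    (hS₀ : S₀ ∈ R.powerset) (hcard : S₀.card ≤ 2 * L)
    (h0 : ∀ S ∈ R.powerset, S.card ≤ 2 * L → S ≠ S₀ → pairTerm ρ β S A B = 0) :
    |∑ S ∈ R.powerset, pairTerm ρ β S A B - pairTerm ρ β S₀ A B| ≤
      2 ^ R.card * (N ^ 2 * (2 * β * N) ^ (2 * L + 1)) := by
  rw [← sum_filter_add_sum_filter_not R.powerset (fun S => 2 * L < S.card)]
  have hmem : S₀ ∈ R.powerset.filter (fun S => ¬ 2 * L < S.card) :=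
    mem_filter.2 ⟨hS₀, not_lt.2 hcard⟩
  have hz : ∑ S ∈ R.powerset.filter (fun S => ¬ 2 * L < S.card), pairTerm ρ β S A B =
      pairTerm ρ β S₀ A B := by
    rw [← add_sum_erase _ _ hmem, sum_eq_zero fun S hS => ?_, add_zero]
    have hS' := mem_filter.1 (mem_of_mem_erase hS)
    exact h0 S hS'.1 (not_lt.1 hS'.2) (ne_of_mem_erase hS)
  rw [hz, add_sub_cancel_right]
  exact abs_sum_pairTerm_filter_lt_card_le ρ β hρ hβ hγ R A B

end Expansion

end DiagRPRest

end

end Summit.QuantumFields.GaugeBoot
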